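import Mathlib
import HarnessLib
import Literature.Analysis.ValidatedNumerics.MultiPrecisionInterval
import Literature.MathematicalPhysics.QuantumLattice.HubbardFermiRadiusSmooth
import Summits.HubbardSuperconductivity.HubbardSuperconductivity.Theorems.KLProgrammeFreeBandJetAlgebra
import Summits.HubbardSuperconductivity.HubbardSuperconductivity.Theorems.KLProgrammeFreeBandJetCheckSound

/-!
# Route `KLProgramme` — ENGINE crux `KLRegimeEngineV17F2` (stmt-HubbardSuperconductivity-20437), row (C) `stub_twoLeg_curvature`,
# producer hypothesis `hcertA : KlwjCertA` — KLWJ-INKERNEL part 2b: SOUNDNESS OF THE BOX CHECKER, II (boxes, leaves, the certificate)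
# (cell gate-hubbard-kl, seat hubbard-kl-k3c5-p1 g21; docket «KLWJ-INKERNEL-ROUTE» (p1b g19 memo 5340b98f1348eb46); 0 kit)

Sequel of `…FreeBandJetCheckSound` (relational parametricity; `mem_eval_out`: a `some I` output of the interval run of a program
encloses the value of the term held by its free run; `abs_le_of_bddAbs`).  Here:
* §3 the trigonometric hull `trigEncl` is sound on `[0, π]` (`MC.mem_expI` at the endpoints; `cos` antitone on `[0, π]`, `sin` monotone
  on `[0, π/2]` and antitone on `[π/2, π]`), the rational box enclosure `ivOfRat`, and `boxAtoms_sound`: for `θ ∈ [θ₀, θ₁]`,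
  `t ∈ [t₀, t₁]` the seven atoms `atomsAt θ t`, the radial slope `W = ∂_tF(θ, t)` and the level `F(θ, t)` lie in the computed intervals;
* §4 **`checkLeaf_sound`** (all thirteen rows `|⟦treeAlg.out prog r⟧(θ, t)| ≤ B` hold at every point of the box),
  **`skipLeaf_sound`** (`F(θ, t) ∉ [a, b]` on the box) and **`checkCert_sound`**: a passing certificate on a root box gives, at every
  point of the box with `F(θ, t) ∈ [a, b]`, the thirteen rows (`JetRows`).
Everything generic in the program, the table, the window and the parameters; nothing here asserts any table entry, row (C), any stub
of 20437, K3, U₀, the window, a margin or superconductivity in the Hubbard model.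
References: R. E. Moore, *Interval Analysis* (1966), Ch. 3–4 (inclusion isotonicity; the natural interval extension) [folklore].
-/

noncomputable section

namespace Summit.HubbardSuperconductivity.HubbardSuperconductivity.Theorems.FreeBandJets

set_option linter.dupNamespace false -- summit = problem name (single-conjunct summit), D-0017

open Real Set Literature.Analysis.ValidatedNumerics.NumericsMP Literature.MathematicalPhysics.QuantumLattice

/-! ## §3 Trigonometric hulls, rational boxes, the atoms of a box -/

/-- `ivOfRat` encloses the rational interval. -/
theorem mem_ivOfRat {S : ℕ} {lo hi : ℚ} {x : ℝ} (h1 : (lo : ℝ) ≤ x) (h2 : x ≤ hi) : MI.mem S x (ivOfRat S lo hi) := by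
  have hSr : (0 : ℝ) ≤ S := by positivity
  constructor
  · have hf : ((Rat.floor (lo * S) : ℤ) : ℚ) ≤ lo * S := Rat.floor_le _
    have hf' : ((Rat.floor (lo * S) : ℤ) : ℝ) ≤ (lo : ℝ) * S := by exact_mod_cast hf
    simp only [ivOfRat]
    exact hf'.trans (by nlinarith)
  · have hf : ((Rat.floor (-hi * S) : ℤ) : ℚ) ≤ -hi * S := Rat.floor_le _
    have hf' : ((Rat.floor (-hi * S) : ℤ) : ℝ) ≤ -(hi : ℝ) * S := by exact_mod_cast hf
    simp only [ivOfRat, Int.cast_neg]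
    nlinarith

/-- `sin` is antitone on `[π/2, π]`. -/
theorem sin_le_sin_of_pi_div_two_le {x y : ℝ} (hx : π / 2 ≤ x) (hxy : x ≤ y) (hy : y ≤ π) : Real.sin y ≤ Real.sin x := by
  rw [← Real.sin_pi_sub x, ← Real.sin_pi_sub y]
  exact Real.sin_le_sin_of_le_of_le_pi_div_two (by linarith) (by linarith) (by linarith)

/-- **The trigonometric hull is sound**: for `x ∈ X ⊆ [0, π]`, `cos x` and `sin x` lie in `trigEncl P X`. [folklore] -/
theorem trigEncl_sound (P : Prm) (hS : 0 < P.S) (hpi : MI.mem P.S Real.pi P.piI) {X C Sn : MI}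
    (h : trigEncl P X = some (C, Sn)) {x : ℝ} (hx : MI.mem P.S x X) :
    MI.mem P.S (Real.cos x) C ∧ MI.mem P.S (Real.sin x) Sn := by
  have hSr : (0 : ℝ) < P.S := by exact_mod_cast hS
  unfold trigEncl at h
  by_cases hrange : 0 ≤ X.lo ∧ X.hi ≤ P.piI.lo
  · rw [if_pos hrange] at h
    obtain ⟨hlo0, hhipi⟩ := hrange
    simp only [Option.bind_eq_some_iff] at h
    obtain ⟨eL, heL, eH, heH, hCS⟩ := h
    simp only [Option.some.injEq, Prod.mk.injEq] at hCS
    obtain ⟨hC, hSn⟩ := hCS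
    -- the endpoints
    set a : ℝ := (X.lo : ℝ) / P.S with ha
    set b : ℝ := (X.hi : ℝ) / P.S with hb
    have hax : a ≤ x := MI.lo_div_le hS hx
    have hxb : x ≤ b := MI.le_hi_div hS hx
    have ha0 : 0 ≤ a := by rw [ha]; exact div_nonneg (by exact_mod_cast hlo0) hSr.le
    have hbpi : b ≤ π := by
      rw [hb, div_le_iff₀ hSr]
      exact le_trans (by exact_mod_cast hhipi) hpi.1
    have hx0 : 0 ≤ x := ha0.trans hax
    have hxpi : x ≤ π := hxb.trans hbpi
    have hmemA := MC.mem_expI hS hpi heL (MI.mem_lower hS X)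
    have hmemB := MC.mem_expI hS hpi heH (MI.mem_upper hS X)
    have hcosA : MI.mem P.S (Real.cos a) eL.re := by
      have := hmemA.1; rwa [Complex.exp_ofReal_mul_I_re] at this
    have hsinA : MI.mem P.S (Real.sin a) eL.im := by
      have := hmemA.2; rwa [Complex.exp_ofReal_mul_I_im] at this
    have hcosB : MI.mem P.S (Real.cos b) eH.re := by
      have := hmemB.1; rwa [Complex.exp_ofReal_mul_I_re] at this
    have hsinB : MI.mem P.S (Real.sin b) eH.im := by
      have := hmemB.2; rwa [Complex.exp_ofReal_mul_I_im] at this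
    refine ⟨?_, ?_⟩
    · -- cosine: antitone on `[0, π]`
      rw [← hC]
      constructor
      · have h1 : Real.cos b ≤ Real.cos x := Real.cos_le_cos_of_nonneg_of_le_pi hx0 hbpi hxb
        exact hcosB.1.trans (by nlinarith)
      · have h1 : Real.cos x ≤ Real.cos a := Real.cos_le_cos_of_nonneg_of_le_pi ha0 hxpi hax
        exact le_trans (by nlinarith) hcosA.2
    · -- sine
      rw [← hSn]
      constructor
      · -- lower bound: the minimum of the endpoint sines
        show ((min eL.im.lo eH.im.lo : ℤ) : ℝ) ≤ Real.sin x * P.S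
        rcases le_total x (π / 2) with hxm | hxm
        · have h1 : Real.sin a ≤ Real.sin x :=
            Real.sin_le_sin_of_le_of_le_pi_div_two (by linarith [Real.pi_pos]) hxm hax
          have h2 : ((min eL.im.lo eH.im.lo : ℤ) : ℝ) ≤ eL.im.lo := by exact_mod_cast min_le_left _ _
          exact h2.trans (hsinA.1.trans (by nlinarith))
        · have h1 : Real.sin b ≤ Real.sin x := sin_le_sin_of_pi_div_two_le hxm hxb hbpi
          have h2 : ((min eL.im.lo eH.im.lo : ℤ) : ℝ) ≤ eH.im.lo := by exact_mod_cast min_le_right _ _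
          exact h2.trans (hsinB.1.trans (by nlinarith))
      · -- upper bound: three cases
        show Real.sin x * P.S ≤ ((sinUpper P X eL eH : ℤ) : ℝ)
        unfold sinUpper
        by_cases hhi : 2 * X.hi ≤ P.piI.lo
        · -- `X ⊆ [0, π/2]`
          rw [if_pos hhi]
          have hb2 : b ≤ π / 2 := by
            rw [hb, div_le_iff₀ hSr]
            have : (2 * X.hi : ℝ) ≤ P.piI.lo := by exact_mod_cast hhi
            linarith [hpi.1]
          have h1 : Real.sin x ≤ Real.sin b :=
            Real.sin_le_sin_of_le_of_le_pi_div_two (by linarith [Real.pi_pos]) hb2 hxb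
          exact le_trans (by nlinarith) hsinB.2
        · rw [if_neg hhi]
          by_cases hlo : P.piI.hi ≤ 2 * X.lo
          · -- `X ⊆ [π/2, π]`
            rw [if_pos hlo]
            have ha2 : π / 2 ≤ a := by
              rw [ha, le_div_iff₀ hSr]
              have : (P.piI.hi : ℝ) ≤ 2 * X.lo := by exact_mod_cast hlo
              linarith [hpi.2]
            have h1 : Real.sin x ≤ Real.sin a := sin_le_sin_of_pi_div_two_le ha2 hax hxpi
            exact le_trans (by nlinarith) hsinA.2
          · rw [if_neg hlo]
            have h1 : Real.sin x ≤ 1 := Real.sin_le_one x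
            have : Real.sin x * P.S ≤ P.S := by nlinarith
            simpa using this
  · rw [if_neg hrange] at h
    simp at h

/-- **The atoms of a box are enclosed**: for `θ ∈ [θ₀, θ₁]`, `t ∈ [t₀, t₁]`, the seven atoms, the radial slope `W` and the level
`F(θ, t)` lie in the intervals of `boxAtoms`. -/
theorem boxAtoms_sound (P : Prm) (hS : 0 < P.S) (hpi : MI.mem P.S Real.pi P.piI) {th0 th1 t0 t1 : ℚ} {at7 : Atoms7}
    (h : boxAtoms P th0 th1 t0 t1 = some at7) {θ t : ℝ} (hθ0 : (th0 : ℝ) ≤ θ) (hθ1 : θ ≤ th1) (ht0 : (t0 : ℝ) ≤ t)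
    (ht1 : t ≤ t1) :
    (∀ i, MI.mem P.S (JE.atomsAt θ t i) (at7.toFun P.S i)) ∧ MI.mem P.S (JE.wval (JE.atomsAt θ t)) (at7.W P.S) ∧
      MI.mem P.S (rayDispersion (θ, t)) at7.F := by
  have hΘ : MI.mem P.S θ (ivOfRat P.S th0 th1) := mem_ivOfRat hθ0 hθ1
  have hT : MI.mem P.S t (ivOfRat P.S t0 t1) := mem_ivOfRat ht0 ht1
  unfold boxAtoms at h
  simp only [Option.bind_eq_some_iff] at h
  obtain ⟨cs, hcs, e1, he1, e2, he2, hat⟩ := h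
  simp only [Option.some.injEq] at hat
  subst hat
  obtain ⟨c, s⟩ := cs
  obtain ⟨c1, s1⟩ := e1
  obtain ⟨c2, s2⟩ := e2
  have hcs' := trigEncl_sound P hS hpi hcs hΘ
  have hA1 : MI.mem P.S (t * Real.cos θ) ((ivOfRat P.S t0 t1).mul P.S c) := MI.mem_mul hS hT hcs'.1
  have hA2 : MI.mem P.S (t * Real.sin θ) ((ivOfRat P.S t0 t1).mul P.S s) := MI.mem_mul hS hT hcs'.2
  have h1' := trigEncl_sound P hS hpi he1 hA1
  have h2' := trigEncl_sound P hS hpi he2 hA2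
  have hatoms : ∀ i, MI.mem P.S (JE.atomsAt θ t i) (Atoms7.toFun P.S ⟨c, s, ivOfRat P.S t0 t1, s1, c1, s2, c2⟩ i) := by
    intro i
    match i with
    | 0 => exact hcs'.1
    | 1 => exact hcs'.2
    | 2 => exact hT
    | 3 => exact h1'.2
    | 4 => exact h1'.1
    | 5 => exact h2'.2
    | 6 => exact h2'.1
    | n + 7 =>
        rw [JE.atomsAt_of_ge (by omega)]
        simpa [Atoms7.toFun] using MI.mem_ofInt P.S 0
  refine ⟨hatoms, ?_, ?_⟩
  · -- `W = 2(c·s1 + s·s2)`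
    have hm := MI.mem_mulInt (MI.mem_add (MI.mem_mul hS hcs'.1 h1'.2) (MI.mem_mul hS hcs'.2 h2'.2)) 2
    simp only [JE.wval, Atoms7.W, JE.atomsAt_zero, JE.atomsAt_three, JE.atomsAt_one, JE.atomsAt_five]
    convert hm using 1
    push_cast; ring
  · -- `F = -2(c1 + c2)`
    have hm := MI.mem_mulInt (MI.mem_add h1'.1 h2'.1) (-2)
    rw [rayDispersion_eq]
    simp only [Atoms7.F]
    convert hm using 1
    push_cast; ring

/-! ## §4 What the leaf checks and the certificate mean -/

/-- The thirteen rows of the table at the point `(θ, t)`, read on the terms held by the free run of the program. -/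
def JetRows (prog : List Ins) (ix : Regix) (tab : Tab) (θ t : ℝ) : Prop :=
  let v : ℕ → ℝ := fun r => (treeAlg.out prog r).eval (JE.atomsAt θ t)
  |v ix.rR1| ≤ tab.R1 ∧ |v ix.rR2| ≤ tab.R2 ∧ |v ix.rR3| ≤ tab.R3 ∧ |v ix.rR4| ≤ tab.R4 ∧
  |v ix.rD1| ≤ tab.D1 ∧ |v ix.rD2| ≤ tab.D2 ∧ |v ix.rD3| ≤ tab.D3 ∧ |v ix.rD4| ≤ tab.D4 ∧
  |v ix.rG0| ≤ tab.G0 ∧ |v ix.rG1| ≤ tab.G1 ∧ |v ix.rG2| ≤ tab.G2 ∧ |v ix.rG3| ≤ tab.G3 ∧ |v ix.rG4| ≤ tab.G4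

/-- **`checkLeaf` is sound**: the thirteen rows hold at every point of the box. -/
theorem checkLeaf_sound (P : Prm) (hS : 0 < P.S) (hpi : MI.mem P.S Real.pi P.piI) (prog : List Ins) (ix : Regix) (tab : Tab)
    {th0 th1 t0 t1 : ℚ} (h : checkLeaf P prog ix tab th0 th1 t0 t1 = true) {θ t : ℝ} (hθ0 : (th0 : ℝ) ≤ θ) (hθ1 : θ ≤ th1)
    (ht0 : (t0 : ℝ) ≤ t) (ht1 : t ≤ t1) : JetRows prog ix tab θ t := by
  unfold checkLeaf at h
  split at h
  · simp at h
  · rename_i at7 hat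
    obtain ⟨hatoms, hW, -⟩ := boxAtoms_sound P hS hpi hat hθ0 hθ1 ht0 ht1
    simp only [Bool.and_eq_true, decide_eq_true_eq] at h
    obtain ⟨⟨⟨⟨⟨⟨⟨⟨⟨⟨⟨⟨⟨-, h1⟩, h2⟩, h3⟩, h4⟩, h5⟩, h6⟩, h7⟩, h8⟩, h9⟩, h10⟩, h11⟩, h12⟩, h13⟩ := h
    have key : ∀ r, EnclOpt P.S ((treeAlg.out prog r).eval (JE.atomsAt θ t))
        ((Alg.runAll (ivAlg P.S (at7.toFun P.S) (at7.W P.S)) prog).getD none r) := by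
      intro r I hI
      exact mem_eval_out hS hatoms hW prog r hI
    exact ⟨abs_le_of_bddAbs hS (key _) h1, abs_le_of_bddAbs hS (key _) h2, abs_le_of_bddAbs hS (key _) h3,
      abs_le_of_bddAbs hS (key _) h4, abs_le_of_bddAbs hS (key _) h5, abs_le_of_bddAbs hS (key _) h6,
      abs_le_of_bddAbs hS (key _) h7, abs_le_of_bddAbs hS (key _) h8, abs_le_of_bddAbs hS (key _) h9,
      abs_le_of_bddAbs hS (key _) h10, abs_le_of_bddAbs hS (key _) h11, abs_le_of_bddAbs hS (key _) h12,
      abs_le_of_bddAbs hS (key _) h13⟩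

/-- **`skipLeaf` is sound**: the level `F(θ, t)` misses `[a, b]` at every point of the box. -/
theorem skipLeaf_sound (P : Prm) (hS : 0 < P.S) (hpi : MI.mem P.S Real.pi P.piI) {a b th0 th1 t0 t1 : ℚ}
    (h : skipLeaf P a b th0 th1 t0 t1 = true) {θ t : ℝ} (hθ0 : (th0 : ℝ) ≤ θ) (hθ1 : θ ≤ th1) (ht0 : (t0 : ℝ) ≤ t)
    (ht1 : t ≤ t1) : rayDispersion (θ, t) < a ∨ (b : ℝ) < rayDispersion (θ, t) := by
  unfold skipLeaf at h
  split at h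
  · simp at h
  · rename_i at7 hat
    obtain ⟨-, -, hF⟩ := boxAtoms_sound P hS hpi hat hθ0 hθ1 ht0 ht1
    have hSr : (0 : ℝ) < P.S := by exact_mod_cast hS
    have ha : (a : ℝ) = a.num / a.den := by exact_mod_cast (Rat.num_div_den a).symm
    have hb : (b : ℝ) = b.num / b.den := by exact_mod_cast (Rat.num_div_den b).symm
    have hda : (0 : ℝ) < a.den := by exact_mod_cast a.den_pos
    have hdb : (0 : ℝ) < b.den := by exact_mod_cast b.den_pos
    simp only [Bool.or_eq_true, decide_eq_true_eq] at h
    rcases h with h | h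
    · left
      have h' : (at7.F.hi : ℝ) * a.den < a.num * P.S := by exact_mod_cast h
      rw [ha, lt_div_iff₀ hda]
      nlinarith [hF.2]
    · right
      have h' : (b.num : ℝ) * P.S < at7.F.lo * b.den := by exact_mod_cast h
      rw [hb, div_lt_iff₀ hdb]
      nlinarith [hF.1]

/-- **The certificate checker is sound**: if `checkCert` accepts a certificate on the box `[θ₀, θ₁] × [t₀, t₁]`, then at every point
of the box whose level `F(θ, t)` lies in `[a, b]` the thirteen rows of the table hold. [folklore] -/
theorem checkCert_sound (P : Prm) (hS : 0 < P.S) (hpi : MI.mem P.S Real.pi P.piI) (prog : List Ins) (ix : Regix) (tab : Tab)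
    (a b : ℚ) : ∀ (c : Cert) {th0 th1 t0 t1 : ℚ}, checkCert P prog ix tab a b th0 th1 t0 t1 c = true →
      ∀ {θ t : ℝ}, (th0 : ℝ) ≤ θ → θ ≤ th1 → (t0 : ℝ) ≤ t → t ≤ t1 →
        (a : ℝ) ≤ rayDispersion (θ, t) → rayDispersion (θ, t) ≤ b → JetRows prog ix tab θ t
  | Cert.ok, _, _, _, _, h, θ, t, hθ0, hθ1, ht0, ht1, _, _ =>
      checkLeaf_sound P hS hpi prog ix tab h hθ0 hθ1 ht0 ht1
  | Cert.skip, _, _, _, _, h, θ, t, hθ0, hθ1, ht0, ht1, ha, hb => by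
      rcases skipLeaf_sound P hS hpi h hθ0 hθ1 ht0 ht1 with h' | h' <;> linarith
  | Cert.splitH l r, th0, th1, t0, t1, h, θ, t, hθ0, hθ1, ht0, ht1, ha, hb => by
      simp only [checkCert, Bool.and_eq_true] at h
      rcases le_total θ (((th0 + th1) / 2 : ℚ) : ℝ) with hm | hm
      · exact checkCert_sound P hS hpi prog ix tab a b l h.1 hθ0 hm ht0 ht1 ha hb
      · exact checkCert_sound P hS hpi prog ix tab a b r h.2 hm hθ1 ht0 ht1 ha hb
  | Cert.splitV l r, th0, th1, t0, t1, h, θ, t, hθ0, hθ1, ht0, ht1, ha, hb => by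
      simp only [checkCert, Bool.and_eq_true] at h
      rcases le_total t (((t0 + t1) / 2 : ℚ) : ℝ) with hm | hm
      · exact checkCert_sound P hS hpi prog ix tab a b l h.1 hθ0 hθ1 ht0 hm ha hb
      · exact checkCert_sound P hS hpi prog ix tab a b r h.2 hθ0 hθ1 hm ht1 ha hb

end Summit.HubbardSuperconductivity.HubbardSuperconductivity.Theorems.FreeBandJets

end
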